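import Mathlib
import Summits.Ventures.HodgeRepro.OcticCMPointDualSign
import Summits.Ventures.HodgeRepro.OcticCMPointTruncSign
import Summits.Ventures.HodgeRepro.OcticCMPointTruncFour
import Summits.Ventures.HodgeRepro.OcticCMPointInertSign
import Summits.Ventures.HodgeRepro.OcticCMPointTameModel

/-!
# OcticCMPointS3Signs — the local root numbers at the three places of `S₃` of the octic point, in one statement

Blind re-derivation cell `pub-hodge-repro`, seat night-2 (gen 4).  Target tree path
`lean/Summits/Ventures/HodgeRepro/OcticCMPointS3Signs.lean`.  The capstone of the gen-4 set: ROUTE-B §9.9 (f)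
(`ε_v(½, ν♭, ψ_δ) = ±1 for every conjugate-dual ν♭`) and (E2)/(E3) of §9 at the places of `S₃` of
`E = ℚ(ζ₅, √(4+√5))`, as theorems of the transcribed rings (`OcticCMPointDualModel / TruncModel / InertModel`):

* **`S3_signs`** — at `𝔭₁, 𝔭₂ | 5` for every conductor `2 ≤ c ≤ 4` and at `𝔮 | 2` at conductor `1`, the local
  root number of every conjugate-dual character (conductor exactly `c`, `ω(ϖ)² = ω(−1)` resp. `ω(ϖ)² = 1`) is
  `±1` — the three clauses `eps_sign_trunc_p5`, `eps_sign_of_conductor_two` (closed form `ω(ϖ)^n θ(β)`) and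
  `eps_sign_inert_quarter` in one conjunction;
* **`twisted_tame_lines_p5`** — (E2) and (E3) at `𝔭 | 5` for the tame lines twisted by the explicit conductor-`4`
  twist: `ε(½, χρ, ψ_δ) = (χ(ϖ) ρ(ϖ))^n` and the product identity from the `ϖ`-part of N2
  (`eps_tame_twist_four`, `E3_tame_twist_four` with `κ = 1/25`);
* **`conductor_one_signs`** — conductor `1` exactly: `ε(½, ⟨χ_quad, ω(ϖ)⟩, ψ₅) = ω(ϖ)^n` at `𝔭` (Gauss's sign at
  `𝔽₅`) and `ε = ±ω(ϖ)^n` at `𝔮`.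

**What this is not.**  The four `χ′_j` of the octic face are on no page — the statements are for the whole
families of characters named; `c ≥ 5` at `𝔭 | 5` and `c ≥ 2` at `𝔮` are not covered.  Nothing here says
anything about the status of the Hodge conjecture for CM abelian varieties, which is NOT proved.
-/

set_option autoImplicit false

noncomputable section

namespace Summit.Ventures.HodgeRepro.PeriodCloser

open GaussSumStability

/-- **The local root numbers at `S₃` of the octic point are signs**: (i) `𝔭₁, 𝔭₂ | 5`, every conductor
`2 ≤ c ≤ 4`, every conjugate-dual `ω` of conductor exactly `c`; (ii) `𝔭₁, 𝔭₂ | 5`, conductor `2`, in closed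
form `ω(ϖ)^n θ(β)`; (iii) `𝔮 | 2`, conductor `1`, every tame conjugate-dual `ω` with `ω(ϖ)² = 1`. -/
theorem S3_signs :
    (∀ (c : ℕ), 2 ≤ c → ∀ (ψ₀ : AddChar (ZMod 5) ℂ), ψ₀.IsPrimitive →
        ∀ (ω : LocalChar (TruncModel.Trunc (ZMod 5) c)),
        (∃ z₀, PsiAnn (TruncModel.psiTilde c ψ₀) (TruncModel.maxIdeal c) z₀ ∧ ω.unit (1 + z₀) ≠ 1) →
        ω.piVal ≠ 0 → (∀ x, ω.unit (TruncModel.conj c x) = ω.unit⁻¹ x) → ω.piVal ^ 2 = ω.unit (-1) →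
        ∀ n : ℕ, n % 2 = c % 2 →
        LocalChar.eps (LocalChar.kappaHalf (TruncModel.Trunc (ZMod 5) c)) n ω (TruncModel.psiTilde c ψ₀) = 1 ∨
        LocalChar.eps (LocalChar.kappaHalf (TruncModel.Trunc (ZMod 5) c)) n ω (TruncModel.psiTilde c ψ₀) = -1) ∧
    (∀ (ψ₀ : AddChar (ZMod 5) ℂ), ψ₀.IsPrimitive → ∀ (ω : LocalChar (DualNumber (ZMod 5))),
        (∃ z₀ ∈ DualModel.maxIdeal (ZMod 5), ω.unit (1 + z₀) ≠ 1) →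
        (∀ x, ω.unit (DualModel.conj (ZMod 5) x) = ω.unit⁻¹ x) → ω.piVal ^ 2 = ω.unit (-1) →
        ∀ n : ℕ, Even n →
        ∃ θ : MulChar (ZMod 5) ℂ, ∃ β : ZMod 5, β ≠ 0 ∧ ω.unit = DualModel.tameWild θ β ψ₀ ∧ θ β * θ β = 1 ∧
          LocalChar.eps ((1 / 5 : ℝ) : ℂ) n ω (DualModel.psiTilde ψ₀) = ω.piVal ^ n * θ β ∧
          (LocalChar.eps ((1 / 5 : ℝ) : ℂ) n ω (DualModel.psiTilde ψ₀) = 1 ∨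
            LocalChar.eps ((1 / 5 : ℝ) : ℂ) n ω (DualModel.psiTilde ψ₀) = -1)) ∧
    (∀ (n : ℕ) (ω : LocalChar InertModel.F16), ω.unit ≠ 1 → ω.piVal ≠ 0 →
        (∀ x, ω.unit (InertModel.conj x) = ω.unit⁻¹ x) → ω.piVal ^ 2 = 1 →
        LocalChar.eps (1 / 4) n ω (InertModel.psiTilde InertModel.psi0) = 1 ∨
          LocalChar.eps (1 / 4) n ω (InertModel.psiTilde InertModel.psi0) = -1) := by
  refine ⟨?_, ?_, ?_⟩
  · intro c hc ψ₀ h₀ ω hprim hπ hσω hπ2 n hn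
    exact TruncModel.eps_sign_trunc_p5 c hc ψ₀ h₀ ω hprim hπ hσω hπ2 n hn
  · intro ψ₀ h₀ ω hcond hσω hπ2 n hn
    exact DualModel.eps_sign_of_conductor_two ω ψ₀ h₀ hcond hσω hπ2 n hn _ DualModel.kappa_mul_card_p5
  · intro n ω hω hπ hσω hπ2
    exact InertModel.eps_sign_inert_quarter n ω hω hπ hσω hπ2

/-- **(E2) and (E3) at `𝔭₁, 𝔭₂ | 5` for the tame lines twisted by the explicit conductor-`4` twist**, with
`κ = 1/25`: `ε(½, χρ, ψ_δ) = (χ(ϖ) ρ(ϖ))^n` for every tame line `χ`, and the (E3) product identity follows from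
the `ϖ`-part of N2. -/
theorem twisted_tame_lines_p5 (ψ₀ : AddChar (ZMod 5) ℂ) (h₀ : ψ₀.IsPrimitive) (n : ℕ) :
    (∀ (θ : MulChar (ZMod 5) ℂ) (πχ π : ℂ),
        LocalChar.eps ((1 / 25 : ℝ) : ℂ) n
          ((⟨TruncModel.tame 4 (by norm_num) θ, πχ⟩ : LocalChar (TruncModel.Trunc (ZMod 5) 4)) *
            ⟨TruncModel.twist 4 (by norm_num) (by norm_num) (by decide) (by decide) 1 ψ₀, π⟩)
          (TruncModel.psiTilde 4 ψ₀) = (πχ * π) ^ n) ∧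
    (∀ (θ : Fin 4 → MulChar (ZMod 5) ℂ) (π' : Fin 4 → ℂ) (π : ℂ), π' 0 * π' 1 = π' 2 * π' 3 →
        LocalChar.eps ((1 / 25 : ℝ) : ℂ) n
            ((⟨TruncModel.tame 4 (by norm_num) (θ 0), π' 0⟩ : LocalChar (TruncModel.Trunc (ZMod 5) 4)) *
              ⟨TruncModel.twist 4 (by norm_num) (by norm_num) (by decide) (by decide) 1 ψ₀, π⟩)
            (TruncModel.psiTilde 4 ψ₀) *
          LocalChar.eps ((1 / 25 : ℝ) : ℂ) n
            ((⟨TruncModel.tame 4 (by norm_num) (θ 1), π' 1⟩ : LocalChar (TruncModel.Trunc (ZMod 5) 4)) *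
              ⟨TruncModel.twist 4 (by norm_num) (by norm_num) (by decide) (by decide) 1 ψ₀, π⟩)
            (TruncModel.psiTilde 4 ψ₀) =
        LocalChar.eps ((1 / 25 : ℝ) : ℂ) n
            ((⟨TruncModel.tame 4 (by norm_num) (θ 2), π' 2⟩ : LocalChar (TruncModel.Trunc (ZMod 5) 4)) *
              ⟨TruncModel.twist 4 (by norm_num) (by norm_num) (by decide) (by decide) 1 ψ₀, π⟩)
            (TruncModel.psiTilde 4 ψ₀) *
          LocalChar.eps ((1 / 25 : ℝ) : ℂ) n
            ((⟨TruncModel.tame 4 (by norm_num) (θ 3), π' 3⟩ : LocalChar (TruncModel.Trunc (ZMod 5) 4)) *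
              ⟨TruncModel.twist 4 (by norm_num) (by norm_num) (by decide) (by decide) 1 ψ₀, π⟩)
            (TruncModel.psiTilde 4 ψ₀)) := by
  refine ⟨fun θ πχ π => ?_, fun θ π' π hN2 => ?_⟩
  · exact TruncModel.eps_tame_twist_four (by decide) (by decide) ψ₀ h₀ _ TruncModel.kappa_mul_card_sq_p5 n θ πχ π
  · exact TruncModel.E3_tame_twist_four (by decide) (by decide) ψ₀ h₀ _ TruncModel.kappa_mul_card_sq_p5 n θ π' π hN2

/-- **Conductor `1` at `𝔭₁, 𝔭₂ | 5` and at `𝔮 | 2`, exactly** (`OcticCMPointTameModel` / `OcticCMPointInertModel`):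
for the standard `ψ₅`, `ε(½, ⟨χ_quad, ω(ϖ)⟩, ψ₅) = ω(ϖ)^n` at `𝔭`; at `𝔮`, `ε(½, ω, ψ̃) = ±ω(ϖ)^n` for every
non-trivial conjugate-dual tame `ω`, with no hypothesis on `ω(ϖ)`. -/
theorem conductor_one_signs (n : ℕ) :
    (∀ π : ℂ, LocalChar.eps (((Real.sqrt 5)⁻¹ : ℝ) : ℂ) n (⟨TameModel.quadChar5, π⟩ : LocalChar (ZMod 5))
        TameModel.psi5 = π ^ n) ∧
    (∀ ω : LocalChar InertModel.F16, ω.unit ≠ 1 → (∀ x, ω.unit (InertModel.conj x) = ω.unit⁻¹ x) →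
        LocalChar.eps (1 / 4) n ω (InertModel.psiTilde InertModel.psi0) = ω.piVal ^ n ∨
          LocalChar.eps (1 / 4) n ω (InertModel.psiTilde InertModel.psi0) = -ω.piVal ^ n) :=
  ⟨fun π => TameModel.eps_quad_psi5 n π,
    fun ω hω hσ => InertModel.eps_eq_pm_piVal_pow InertModel.psi0 InertModel.psi0_one_ne_one n ω hω hσ⟩

end Summit.Ventures.HodgeRepro.PeriodCloser

end
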